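import Summits.Ventures.PercRepro.C025ProfileThinSimplificationRows

/-!
# THE SIMPLE-THIN THEOREMS IN `M.Indep` / `encard` TERMS (night-3 g17)
SIMPLE-THIN(q) in Mathlib's vocabulary: every `X ⊆ M.E` in which every set of at most two points is independent and whose rank is `q`
has at most `q + 1` points (`X.encard ≤ q + 1`).  `simpleThin_of_indep` converts it to the `rkN` / `Finset` form of
`C025ProfileThinSimplification`, and the three theorems follow: `rls_succ_succ_simpleThin_indep` (C-025 at `(q + 2, q)`, `q ≥ 1`),
`profileIneq_simpleThin_indep`, `hallIneq_simpleThin_indep` (the row `(q, q+1)` and its Hall form, every `q`).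
No `def`, no `instance`, no notation.  Axioms: standard.
-/
open scoped Matroid
namespace PercRepro
open Set Finset ThmH Staged
namespace ThinGirth
variable {α : Type} [DecidableEq α] {M : Matroid α} [M.Finite]

omit [DecidableEq α] in
/-- SIMPLE-THIN(q) in `M.Indep` / `encard` terms gives SIMPLE-THIN(q) in `rkN` / `Finset` terms. -/
theorem simpleThin_of_indep {q : ℕ}
    (hthin : ∀ X ⊆ M.E, (∀ T ⊆ X, T.encard ≤ 2 → M.Indep T) → M.eRk X = (q : ℕ∞) → X.encard ≤ (q + 1 : ℕ)) :
    ∀ X ⊆ gr M, (∀ T ⊆ X, T.card ≤ 2 → rkN M T = T.card) → rkN M X = q → X.card ≤ q + 1 := by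
  intro X hXg hpair hXr
  have hXE : (X : Set α) ⊆ M.E := by
    rw [← coe_gr]
    exact_mod_cast hXg
  have h := hthin X hXE ?_ (by rw [← rkN_eq_iff]; exact hXr)
  · rw [Set.encard_coe_eq_coe_finsetCard] at h
    exact_mod_cast h
  · intro T hT hT2
    obtain ⟨T', rfl⟩ := (X.finite_toSet.subset hT).exists_finset_coe
    have hT'X : T' ⊆ X := by exact_mod_cast hT
    have hT'2 : T'.card ≤ 2 := by
      rw [Set.encard_coe_eq_coe_finsetCard] at hT2
      exact_mod_cast hT2
    rw [Matroid.indep_iff_eRk_eq_encard_of_finite T'.finite_toSet, Set.encard_coe_eq_coe_finsetCard, ← rkN_eq_iff]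
    exact hpair T' hT'X hT'2

/-- **C-025 at `(q + 2, q)` when the simplification is thin**, in `M.Indep` / `encard` terms (`q ≥ 1`). -/
theorem rls_succ_succ_simpleThin_indep (q : ℕ) (hq : 1 ≤ q)
    (hthin : ∀ X ⊆ M.E, (∀ T ⊆ X, T.encard ≤ 2 → M.Indep T) → M.eRk X = (q : ℕ∞) → X.encard ≤ (q + 1 : ℕ)) :
    ThmN.RLS M (q + 2) q :=
  rls_succ_succ_simpleThin q hq M (simpleThin_of_indep hthin)

/-- **The row `(q, q+1)` when the simplification is thin**, in `M.Indep` / `encard` terms. -/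
theorem profileIneq_simpleThin_indep (q : ℕ)
    (hthin : ∀ X ⊆ M.E, (∀ T ⊆ X, T.encard ≤ 2 → M.Indep T) → M.eRk X = (q : ℕ∞) → X.encard ≤ (q + 1 : ℕ)) :
    Profile.ProfileIneq M q (q + 1) :=
  profileIneq_simpleThin q M (simpleThin_of_indep hthin)

/-- **The Hall form `(H⁺_{q,q+1})` when the simplification is thin**, in `M.Indep` / `encard` terms. -/
theorem hallIneq_simpleThin_indep (q : ℕ)
    (hthin : ∀ X ⊆ M.E, (∀ T ⊆ X, T.encard ≤ 2 → M.Indep T) → M.eRk X = (q : ℕ∞) → X.encard ≤ (q + 1 : ℕ)) :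
    Profile.HallIneq M q (q + 1) :=
  hallIneq_simpleThin q M (simpleThin_of_indep hthin)

end ThinGirth
end PercRepro
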